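import Mathlib
import Literature.AlgebraicGeometry.Resolution.CobordantGame
import Literature.AlgebraicGeometry.Resolution.CobordantChartOneMove
import Summits.ResolutionOfSingularities.ResolutionOfSingularities.Theorems.WeightedInvariantLocalWeightedDropG5Won
import Summits.ResolutionOfSingularities.ResolutionOfSingularities.Theorems.WeightedInvariantLocalWeightedDropS1WMoveOne

/-!
# `WeightedInvariant.LocalWeightedDrop`: S1's WILD POINT is WON in two moves by card A's HANDLE

Route `ResolutionOfSingularities/WeightedInvariant`, crux `LocalWeightedDrop`
(stmt-ResolutionOfSingularities-8899).  [OURS · L1 W4.3] — ideator res-L1-w43-idea-1's Sketch v4 / RESULTS-r4 («S1W satP = {u},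
(2;3;4,4) → one tame cusp-cylinder node») and res-L1-w43-tri-1 TRIAGE v7 (K1) («Hauser kangaroo DISCHARGED by card A's own rule
… V(x,s,z)(2,1,1);4 = THE HANDLE → cusp-cylinder → won»), AS A THEOREM: the germ `h = X² + uZ⁴ + u³S⁴` (`0 = X, 1 = Z, 2 = S,
3 = u`; the totally wild `μ₂`-successor of the 4-variable start of §4, cf. `s1w_twistedTrivialFix_u`) is WON in TWO moves over
EVERY field of characteristic `2`.  Nothing here is a statement of the manuscript under review on ladder RESOLUTION;
AI-produced, weaker than expert review.

Move 1 = the HANDLE `(X, (2,1,1,0))` (`…S1WMoveOne`): singular successors `H_γ = X² + uZ⁴ + u³(γ+S)⁴`, `γ ≠ 0`.  Move 2: with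
`β = γ + S`, `W = β²u + Z²`, `μ³ = β/γ` (Hensel in `k⟦S⟧`), the change `X ↦ X + γ⁻¹μ⁻¹·Z·V`, `u ↦ γ⁻²μ⁻⁴·V + γ⁻²μ⁻⁶·Z²`
turns `H_γ` into the CUSP CYLINDER `X² + γ⁻²V³` EXACTLY (same computation as `…G5Won` without the `t`-term); weights
`(X:3, V:2)`, cone smooth off the vertex (`3 ∈ k×`): no singular successor.
-/

set_option linter.dupNamespace false -- mandated namespace of this single-conjunct summit
set_option autoImplicit false

namespace Summit.ResolutionOfSingularities.ResolutionOfSingularities.Theorems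

namespace GradedGame

open MvPowerSeries
open Literature.AlgebraicGeometry.Resolution
open Literature.AlgebraicGeometry.Resolution.CobordantChart

variable {k : Type} [Field k]

section MoveTwo

variable [CharP k 2] (γ : k) (hγ : γ ≠ 0)
include hγ

/-- MOVE TWO at S1W's tame node: a legal move `(θ₂, w₂ = (0,3,0,0,2))` with `H_γ ∘ θ₂ = X² + γ⁻²V³` exactly. [OURS · L1 W4.3] -/
theorem exists_moveTwo_s1wSuccessor :
    ∃ θ : Fin 5 → MvPowerSeries (Fin 5) k, CobordantGame.IsMove k θ ![0, 3, 0, 0, 2] ∧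
      subst θ (X 1 ^ 2 + X 4 * X 2 ^ 4 + X 4 ^ 3 * (C γ + X 3) ^ 4 : MvPowerSeries (Fin 5) k) =
        X 1 ^ 2 + C (γ⁻¹ ^ 2) * X 4 ^ 3 := by
  classical
  haveI : CharP (MvPowerSeries (Fin 5) k) 2 := charP_of_injective_ringHom C_injective 2
  have h2 : (2 : MvPowerSeries (Fin 5) k) = 0 := CharP.ofNat_eq_zero _ 2
  have h3 : ((3 : ℕ) : k) ≠ 0 := by
    rw [show ((3 : ℕ) : k) = 2 + 1 by norm_num, CharP.ofNat_eq_zero k 2, zero_add]; exact one_ne_zero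
  obtain ⟨μ, hμ3, hμ0⟩ := exists_pow_eq_one_add_C_mul_X (k := k) 3 h3 γ⁻¹
  set m : MvPowerSeries (Fin 5) k := embAt 3 μ with hm
  set mi : MvPowerSeries (Fin 5) k := embAt 3 μ⁻¹ with hmi
  have hmmi : m * mi = 1 := by
    rw [hm, hmi, ← embAt_mul, PowerSeries.mul_inv_cancel μ (by rw [hμ0]; exact one_ne_zero), embAt_one]
  have hcmi : constantCoeff mi = 1 := by
    rw [hmi, constantCoeff_embAt, PowerSeries.constantCoeff_inv, hμ0, inv_one]
  have hγγ : (C γ : MvPowerSeries (Fin 5) k) * C γ⁻¹ = 1 := by rw [← map_mul, mul_inv_cancel₀ hγ, map_one]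
  have hβ : (C γ + X 3 : MvPowerSeries (Fin 5) k) = C γ * m ^ 3 := by
    rw [hm, ← embAt_pow, hμ3, embAt_add, embAt_one, embAt_mul, embAt_C, embAt_X, mul_add, mul_one, ← mul_assoc, hγγ,
      one_mul]
  -- the move: `V` lives in the `u`-slot `4`
  set θ : Fin 5 → MvPowerSeries (Fin 5) k := ![X 0, X 1 + C γ⁻¹ * mi * X 2 * X 4, X 2, X 3,
    C (γ⁻¹ ^ 2) * mi ^ 4 * X 4 + C (γ⁻¹ ^ 2) * mi ^ 6 * X 2 * X 2] with hθ
  have hθ0 : θ 0 = X 0 := rfl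
  have hθ1 : θ 1 = X 1 + C γ⁻¹ * mi * X 2 * X 4 := rfl
  have hθ2 : θ 2 = X 2 := rfl
  have hθ3 : θ 3 = X 3 := rfl
  have hθ4 : θ 4 = C (γ⁻¹ ^ 2) * mi ^ 4 * X 4 + C (γ⁻¹ ^ 2) * mi ^ 6 * X 2 * X 2 := rfl
  have hθcc : ∀ i, constantCoeff (θ i) = 0 := by
    intro i
    fin_cases i
    · simp [hθ0, constantCoeff_X]
    · simp [hθ1, constantCoeff_X]
    · simp [hθ2, constantCoeff_X]
    · simp [hθ3, constantCoeff_X]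
    · simp [hθ4, constantCoeff_X]
  have hθs : HasSubst θ := hasSubst_of_constantCoeff_zero hθcc
  refine ⟨θ, ⟨hθcc, ?_, ⟨1, by simp⟩⟩, ?_⟩
  · have hXX : ∀ j a : Fin 5, coeff (Finsupp.single j 1) (X a : MvPowerSeries (Fin 5) k) =
        if j = a then 1 else 0 := fun j a => by
      rw [coeff_X]
      by_cases h : j = a
      · subst h; simp
      · rw [if_neg, if_neg h]
        exact fun h' => h ((Finsupp.single_left_inj one_ne_zero).mp h')
    have hr0 : ∀ j : Fin 5, coeff (Finsupp.single j 1) (θ 0) = if j = 0 then 1 else 0 := fun j => by rw [hθ0, hXX]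
    have hr1 : ∀ j : Fin 5, coeff (Finsupp.single j 1) (θ 1) = if j = 1 then 1 else 0 := fun j => by
      rw [hθ1, map_add, hXX, coeff_single_one_mul_eq_zero _ _ (by simp [constantCoeff_X]) (constantCoeff_X _), add_zero]
    have hr2 : ∀ j : Fin 5, coeff (Finsupp.single j 1) (θ 2) = if j = 2 then 1 else 0 := fun j => by rw [hθ2, hXX]
    have hr3 : ∀ j : Fin 5, coeff (Finsupp.single j 1) (θ 3) = if j = 3 then 1 else 0 := fun j => by rw [hθ3, hXX]
    have hr4 : ∀ j : Fin 5, coeff (Finsupp.single j 1) (θ 4) = if j = 4 then γ⁻¹ ^ 2 else 0 := fun j => by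
      rw [hθ4, map_add, coeff_single_one_mul_X, coeff_single_one_mul_eq_zero _ _ (by simp [constantCoeff_X])
        (constantCoeff_X _), add_zero]
      simp [hcmi]
    have hM : (Matrix.of fun i j : Fin 5 => coeff (Finsupp.single j 1) (θ i)) =
        Matrix.diagonal ![(1 : k), 1, 1, 1, γ⁻¹ ^ 2] := by
      ext i j
      rw [Matrix.of_apply, Matrix.diagonal_apply]
      fin_cases i
      · fin_cases j <;> simp [hr0]
      · fin_cases j <;> simp [hr1]
      · fin_cases j <;> simp [hr2]
      · fin_cases j <;> simp [hr3]
      · fin_cases j <;> simp [hr4]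
    rw [hM, Matrix.det_diagonal]
    simp [Fin.prod_univ_succ, hγ]
  · simp only [subst_add hθs, subst_mul hθs, subst_pow hθs, subst_X hθs, subst_C]
    rw [hθ1, hθ2, hθ3, hθ4, hβ]
    set x1 : MvPowerSeries (Fin 5) k := X 1
    set x2 : MvPowerSeries (Fin 5) k := X 2
    set x4 : MvPowerSeries (Fin 5) k := X 4
    set cg : MvPowerSeries (Fin 5) k := C γ
    set ci : MvPowerSeries (Fin 5) k := C γ⁻¹
    have hci2 : (C (γ⁻¹ ^ 2) : MvPowerSeries (Fin 5) k) = ci ^ 2 := map_pow _ _ _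
    rw [hci2]
    have hsq : (x1 + ci * mi * x2 * x4) ^ 2 = x1 ^ 2 + ci ^ 2 * mi ^ 2 * x2 ^ 2 * x4 ^ 2 := by
      linear_combination (x1 * ci * mi * x2 * x4) * h2
    set U : MvPowerSeries (Fin 5) k := ci ^ 2 * mi ^ 4 * x4 + ci ^ 2 * mi ^ 6 * x2 * x2 with hU
    have hW : (cg * m ^ 3) ^ 2 * U + x2 ^ 2 = m ^ 2 * x4 := by
      rw [hU]
      linear_combination (m ^ 2 * x4 * (cg * ci + 1) * (m * mi) ^ 4 + x2 ^ 2 * (cg * ci + 1) * (m * mi) ^ 6) * hγγ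
        + (m ^ 2 * x4 * ((m * mi) ^ 3 + (m * mi) ^ 2 + m * mi + 1)
          + x2 ^ 2 * ((m * mi) ^ 5 + (m * mi) ^ 4 + (m * mi) ^ 3 + (m * mi) ^ 2 + m * mi + 1)) * hmmi
        + (x2 ^ 2) * h2
    have hF : U * x2 ^ 4 + U ^ 3 * (cg * m ^ 3) ^ 4 = U * ((cg * m ^ 3) ^ 2 * U + x2 ^ 2) ^ 2 := by
      linear_combination (-(U ^ 2 * (cg * m ^ 3) ^ 2 * x2 ^ 2)) * h2
    have hmain : U * (m ^ 2 * x4) ^ 2 = ci ^ 2 * x4 ^ 3 + ci ^ 2 * mi ^ 2 * x2 ^ 2 * x4 ^ 2 := by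
      rw [hU]
      linear_combination (ci ^ 2 * x4 ^ 3 * ((m * mi) ^ 3 + (m * mi) ^ 2 + m * mi + 1)
        + ci ^ 2 * mi ^ 2 * x2 ^ 2 * x4 ^ 2 * ((m * mi) ^ 3 + (m * mi) ^ 2 + m * mi + 1)) * hmmi
    calc (x1 + ci * mi * x2 * x4) ^ 2 + U * x2 ^ 4 + U ^ 3 * (cg * m ^ 3) ^ 4
        = (x1 + ci * mi * x2 * x4) ^ 2 + (U * x2 ^ 4 + U ^ 3 * (cg * m ^ 3) ^ 4) := by ring
      _ = x1 ^ 2 + ci ^ 2 * mi ^ 2 * x2 ^ 2 * x4 ^ 2 + U * (m ^ 2 * x4) ^ 2 := by rw [hsq, hF, hW]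
      _ = x1 ^ 2 + ci ^ 2 * x4 ^ 3 := by
          rw [hmain]; linear_combination (ci ^ 2 * mi ^ 2 * x2 ^ 2 * x4 ^ 2) * h2

/-- THE TAME NODES `H_γ` OF S1W'S HANDLE ARE WON IN ONE MORE MOVE (char 2, every field, `γ ≠ 0`). [OURS · L1 W4.3] -/
theorem won_s1wSuccessor :
    CobordantGame.Won k 5 (X 1 ^ 2 + X 4 * X 2 ^ 4 + X 4 ^ 3 * (C γ + X 3) ^ 4 : MvPowerSeries (Fin 5) k) := by
  classical
  obtain ⟨θ, hmove, hθ⟩ := exists_moveTwo_s1wSuccessor γ hγ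
  set w : Fin 5 → ℕ := ![0, 3, 0, 0, 2] with hw
  set P : MvPolynomial (Fin 5) k := MvPolynomial.X 1 ^ 2 + MvPolynomial.C (γ⁻¹ ^ 2) * MvPolynomial.X 4 ^ 3 with hPdef
  have hcoe : (P : MvPowerSeries (Fin 5) k) = X 1 ^ 2 + C (γ⁻¹ ^ 2) * X 4 ^ 3 := by
    simp [hPdef, MvPolynomial.coe_add, MvPolynomial.coe_mul, MvPolynomial.coe_pow, MvPolynomial.coe_X, MvPolynomial.coe_C]
  have hw1 : w 1 = 3 := rfl
  have hw4 : w 4 = 2 := rfl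
  have hP : P.IsWeightedHomogeneous w 6 := by
    have h1 := MvPolynomial.isWeightedHomogeneous_X (R := k) w 1
    have h4 := MvPolynomial.isWeightedHomogeneous_X (R := k) w 4
    rw [hw1] at h1; rw [hw4] at h4
    have hA : (MvPolynomial.X 1 ^ 2 : MvPolynomial (Fin 5) k).IsWeightedHomogeneous w (2 • 3) := h1.pow 2
    have hB : (MvPolynomial.C (γ⁻¹ ^ 2) * MvPolynomial.X 4 ^ 3 : MvPolynomial (Fin 5) k).IsWeightedHomogeneous w (3 • 2) :=
      (h4.pow 3).C_mul _
    have e1 : (2 • 3 : ℕ) = 6 := rfl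
    have e2 : (3 • 2 : ℕ) = 6 := rfl
    rw [e1] at hA; rw [e2] at hB
    rw [hPdef]
    exact hA.add hB
  have hP0 : P ≠ 0 := by
    intro h0
    have := congrArg (fun Q : MvPolynomial (Fin 5) k => (Q : MvPowerSeries (Fin 5) k)) h0
    simp only [hcoe, MvPolynomial.coe_zero] at this
    have h2 := congrArg (coeff (Finsupp.single (1 : Fin 5) 2)) this
    rw [map_add, coeff_X_pow, if_pos rfl,
      X_dvd_iff.mp ((dvd_pow_self (X 4 : MvPowerSeries (Fin 5) k) (by norm_num)).mul_left _) _ (by simp),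
      map_zero] at h2
    simp at h2
  have h3 : (3 : k) ≠ 0 := by
    rw [show (3 : k) = 2 + 1 by norm_num, CharP.ofNat_eq_zero k 2, zero_add]; exact one_ne_zero
  have hcone : ∀ c : Fin 5 → k, (∀ i, w i = 0 → c i = 0) → MvPolynomial.eval c P = 0 →
      (∀ i, MvPolynomial.eval c (MvPolynomial.pderiv i P) = 0) → c = 0 := by
    intro c hc0 hPc hD
    have hc4 : c 4 = 0 := by
      have := hD 4
      rw [hPdef] at this
      simp only [map_add, map_mul, map_pow, Derivation.leibniz, Derivation.leibniz_pow, MvPolynomial.pderiv_X,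
        MvPolynomial.pderiv_C, MvPolynomial.eval_X, MvPolynomial.eval_C, smul_eq_mul] at this
      simpa [hγ, h3] using this
    have hc1 : c 1 = 0 := by
      rw [hPdef] at hPc
      simp only [map_add, map_mul, map_pow, MvPolynomial.eval_X, MvPolynomial.eval_C] at hPc
      simpa [hc4] using hPc
    funext i
    fin_cases i
    · exact hc0 0 rfl
    · exact hc1
    · exact hc0 2 rfl
    · exact hc0 3 rfl
    · exact hc4
  refine CobordantGame.Won.move θ w hmove fun g hg => ?_
  obtain ⟨c, e, hoff, hfac, hndvd, hsing⟩ := hg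
  rw [hθ, ← hcoe] at hfac
  have hfac' : subst (fun i : Fin 5 => if 0 < w i then
      X (0 : Fin (5 + 1)) ^ (w i) * (C (c i) + X i.succ) else X i.succ)
      (subst (X : Fin 5 → MvPowerSeries (Fin 5) k) (P : MvPowerSeries (Fin 5) k)) = X 0 ^ e * g := by
    rw [MvPowerSeries.subst_self]
    exact hfac
  exact absurd hsing (crux_move_wins_of_isWeightedHomogeneous_offVertex w hP hP0 hcone c hoff e g hfac' hndvd)

end MoveTwo

/-- S1's WILD POINT IS WON IN TWO MOVES by card A's HANDLE: `h = X² + uZ⁴ + u³S⁴` (`0 = X, 1 = Z, 2 = S, 3 = u`), centre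
`V(X, Z, S) ⊇ u`-axis with weights `(2,1,1,0)`, then at each tame node `H_γ` the characteristic-2 move of
`exists_moveTwo_s1wSuccessor` onto the cusp cylinder `X² + γ⁻²V³` and the weights `(3,2)`.  Char `2`, every field.
[OURS · L1 W4.3; idea-1 RESULTS-r4 S1W row / tri-1 TRIAGE v7 (K1), as a theorem] -/
theorem won_s1w [CharP k 2] :
    CobordantGame.Won k 4 (X 0 ^ 2 + X 3 * X 1 ^ 4 + X 3 ^ 3 * X 2 ^ 4 : MvPowerSeries (Fin 4) k) := by
  refine CobordantGame.Won.move MvPowerSeries.X ![2, 1, 1, 0] (isMove_X _ ⟨0, by simp⟩) fun g hg => ?_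
  obtain ⟨γ, hγ, rfl⟩ := s1w_isSuccessor_classification g hg
  exact won_s1wSuccessor γ hγ

end GradedGame

end Summit.ResolutionOfSingularities.ResolutionOfSingularities.Theorems
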